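import Literature.MathematicalPhysics.KineticTheory.ReyBelletThomas2002CrossScaling
import HarnessLib

/-!
# Rey-Bellet–Thomas 2002 with `k₁ < k₂`: the dissipation bound when the interactions dominate

Trunk T-KINETIC (Literature/MathematicalPhysics/KineticTheory). Inline step towards Theorem 3.10 / 2.1
of Rey-Bellet–Thomas, CMP **225** (2002), for the named fact `ReyBelletThomas2002_thm21` in the
regime `k₁ < k₂` (pinning weaker than interaction), following the INTERACTION-DOMINATED half of the
two-regime repair of Cuneo–Eckmann–Hairer–Rey-Bellet, EJP **23** (2018) §5.1 (arXiv:1712.09413),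
adapted to the Rey-Bellet–Thomas reservoirs and proved, as the tree's `k₁ = k₂` core
(`ReyBelletThomas2002DetCore.lean`), by SEQUENTIAL COMPACTNESS:

rescale with the interaction exponent `k₂` (time `t_i = E^{1/k₂-1/2}`); on `{G̃_E ≤ M}` bond lengths
and momenta are bounded while positions may be as large as `E^{1/k₁-1/k₂}`, where however the
rescaled pinning force vanishes uniformly (`ReyBelletThomas2002CrossScaling.lean`); RECENTRE the
positions at `q̃_0(0)` (the drift only sees bond lengths and the — vanishing — pinning force at the
true positions); along `E_n → ∞` with controls `η̃_n → 0` and dissipation `∫|r̃_n|² → 0` the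
recentred drift-driven parts are equi-Lipschitz and bounded, a subsequence converges
(Arzelà–Ascoli) to a solution of the FREE limiting chain
`q̇ = p, ṗ = -∇Φ_∞(q), ṙ = Λ p_ends` (`Φ_∞ = ∑ a₂|q_{i+1} - q_i|^{k₂}`, no pinning, no reservoir
feedback since `k₂ > 2`) with `r ≡ 0`; the cascade (`limit_cascade` with zero pinning force) gives
`p ≡ 0` and equal positions, i.e. the recentred limit starts at `0`, so the rescaled
kinetic+interaction energies `H̃_int(x̃_n(0))` (translation invariant) tend to `0` — contradicting
`H̃_int ≥ H̃_pin` (the regime) and `G̃ ≥ 1/2`.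

* `interaction_core_seq` — the sequential contradiction;
* `interaction_dissipation_lower_bound` — **CEHR Prop. 5.3 / RBT Cor. 3.6 in the interaction
  regime, quantitative rescaled form**: `E₀, δ₀, ε₁ > 0` with `∫₀^{Λ₀}(r̃_L² + r̃_R²) ≥ ε₁` for
  `E ≥ E₀` and every rescaled controlled trajectory on `[0, Λ₀]` with `G̃_E(x̃(0)) ≥ 1/2`,
  `H̃_pin(x̃(0)) ≤ H̃_int(x̃(0))`, `G̃_E ≤ M` along the path and `sup ‖η̃‖ ≤ δ₀`.

## References

* L. Rey-Bellet, L. E. Thomas, Comm. Math. Phys. **225** (2002) 305–329, Thm 3.3, Cor 3.6.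
* N. Cuneo, J.-P. Eckmann, M. Hairer, L. Rey-Bellet, Electron. J. Probab. **23** (2018) no. 55,
  §5.1: Assumption 5.11, (5.12), Lemma 5.13, Prop. 5.14, Remark 5.15, Lemma 5.17.
-/

noncomputable section

open MeasureTheory Filter Topology Set intervalIntegral Metric
open scoped NNReal

namespace Literature.MathematicalPhysics.KineticTheory.HeatConduction

open Literature.Analysis.ODE Literature.MathematicalPhysics.KineticTheory

variable {N : ℕ}

/-! ### The free limiting chain: equal positions from vanishing forces -/

/-- **Vanishing forces of the free chain force equal positions**: with no pinning force and an
injective bond force `fV` with `fV(0) = 0`, if every chain force `F_i(q)` vanishes then all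
positions coincide with `q_0` (from the free end: `fV(q_1 - q_0) = 0 = fV 0`, then inductively).
[cite: ReyBelletThomas2002, Thm 3.3 (proof)] -/
theorem eq_of_forall_rbForceOf_zero_eq_zero {fV : ℝ → ℝ} (hinj : Function.Injective fV) (h0 : fV 0 = 0)
    {q : Fin N → ℝ} (h : ∀ i, rbForceOf (fun _ => (0 : ℝ)) fV N i q = 0) (hN : 0 < N) :
    ∀ i : Fin N, q i = q ⟨0, hN⟩ := by
  -- by induction along the chain: the bond `(n, n+1)` carries no force
  have key : ∀ n : ℕ, ∀ (hn : n + 1 < N), q ⟨n + 1, hn⟩ = q ⟨n, by omega⟩ := by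
    intro n
    induction n with
    | zero =>
      intro hn
      have h1 := h ⟨0, hN⟩
      simp only [rbForceOf, lt_self_iff_false, dif_neg, not_false_eq_true, add_zero, zero_add,
        dif_pos hn, zero_sub, neg_eq_zero] at h1
      have : q ⟨0 + 1, hn⟩ - q ⟨0, hN⟩ = 0 := hinj (h1.trans h0.symm)
      have e : (⟨0 + 1, hn⟩ : Fin N) = ⟨1, by omega⟩ := rfl
      linarith
    | succ m ih =>
      intro hn
      have hm : m + 1 < N := by omega
      have hprev := ih hm
      have h1 := h ⟨m + 1, hm⟩
      simp only [rbForceOf, Nat.succ_pos', dif_pos, zero_add, dif_pos hn] at h1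
      have e1 : (⟨m + 1 - 1, by omega⟩ : Fin N) = ⟨m, by omega⟩ := Fin.ext (by simp)
      rw [e1, hprev, sub_self, h0, zero_sub, neg_eq_zero] at h1
      have : q ⟨m + 1 + 1, hn⟩ - q ⟨m, by omega⟩ = 0 := hinj (h1.trans h0.symm)
      rw [hprev]; linarith
  have all : ∀ n : ℕ, ∀ (hn : n < N), q ⟨n, hn⟩ = q ⟨0, hN⟩ := by
    intro n
    induction n with
    | zero => intro _; rfl
    | succ m ih => intro hn; rw [key m hn, ih (by omega)]
  intro i
  exact all i.val i.isLt

/-! ### The compactness–contradiction argument in the interaction regime -/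

section Core

variable {P : OscillatorChain} {k₁ k₂ : ℝ} (hU : RBGrowth P.U k₁) (hV : RBGrowth P.V k₂)
  (hk₁ : 2 ≤ k₁) (hk : k₁ < k₂) {Λ : ℝ} (hΛ : Λ ≠ 0) (hN : 0 < N) {Λ₀ : ℝ} (hΛ₀ : 0 < Λ₀)
include hU hV hk₁ hk hΛ hN hΛ₀

/-- **The compactness core in the interaction regime (sequential form; CEHR §5.1 for the RBT
reservoirs).** Along any sequence `E_n → ∞`, rescaled (exponent `k₂`) controlled trajectories
`x̃_n = x̃_n(0) + (0, η̃_n) + ∫ Ỹ_{E_n}(x̃_n)` on `[0, Λ₀]` with rescaled energy `≥ 1/2` initially,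
pinning energy at most the kinetic+interaction energy initially, energy `≤ M` throughout, bounded
initial reservoir variables and controls `η̃_n → 0` uniformly CANNOT have dissipation
`∫₀^{Λ₀} |r̃_n|² → 0`: the recentred drift-driven parts have a uniformly convergent subsequence
(Arzelà–Ascoli) whose limit solves the free limiting chain with vanishing dissipation, hence is at
rest with coincident positions (`limit_cascade`, `eq_of_forall_rbForceOf_zero_eq_zero`), so the
translation-invariant rescaled kinetic+interaction energies at time `0` tend to `0`, contradicting
`H̃_int ≥ (G̃ - E^{2/k₂-1}|r̃|²/2)/2 ≥ 1/4 - o(1)`.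
[cite: ReyBelletThomas2002, Thm 3.3 & Cor 3.6 (proof)] -/
theorem interaction_core_seq {M R₀ : ℝ} {Es δ : ℕ → ℝ} {x : ℕ → ℝ → RBPhaseSpace N} {η : ℕ → ℝ → ℝ × ℝ}
    (hE1 : ∀ n, 1 ≤ Es n) (hE : Tendsto Es atTop atTop) (hδ : Tendsto δ atTop (𝓝 0))
    (hδ1 : ∀ n, δ n ≤ 1) (hxc : ∀ n, Continuous (x n))
    (hsol : ∀ n, IsIntegralSolutionOn
      ((P.rbScaled k₂ (Es n)).rbDriftGen Λ N (Es n ^ (2 / k₂ - 1)) (Es n ^ (1 / k₂ - 1 / 2)))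
      (fun s => x n 0 + ((0 : PhaseSpace N), η n s)) (x n) Λ₀)
    (hG0 : ∀ n, 1 / 2 ≤ P.rbScaledEnergy k₂ (Es n) N (x n 0))
    (hreg : ∀ n, (P.rbScaled k₂ (Es n)).pinEnergy N (x n 0).1.1 ≤ (P.rbScaled k₂ (Es n)).intEnergy N (x n 0).1)
    (hr0 : ∀ n, |(x n 0).2.1| ≤ R₀ ∧ |(x n 0).2.2| ≤ R₀)
    (hηb : ∀ n, ∀ s ∈ Icc 0 Λ₀, ‖η n s‖ ≤ δ n)
    (hGM : ∀ n, ∀ s ∈ Icc 0 Λ₀, P.rbScaledEnergy k₂ (Es n) N (x n s) ≤ M) :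
    ¬ Tendsto (fun n => ∫ s in (0 : ℝ)..Λ₀, ((x n s).2.1 ^ 2 + (x n s).2.2 ^ 2)) atTop (𝓝 0) := by
  intro hdiss
  have hk₂ : 2 < k₂ := lt_of_le_of_lt hk₁ hk
  have hk₂' : 2 ≤ k₂ := hk₂.le
  have hk₂0 : 0 < k₂ := by linarith
  -- constants
  obtain ⟨BΔ, Bq, Cp, Cr, M₁, hBΔ, hBq, hCp, hCr, hM₁, hbd⟩ :=
    interaction_scaled_drift_bound (N := N) hU hV hk₁ hk.le Λ M
  have hR₀ : 0 ≤ R₀ := (abs_nonneg _).trans (hr0 0).1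
  have hE0 : ∀ n, 0 < Es n := fun n => by linarith [hE1 n]
  set Y : ℕ → RBPhaseSpace N → RBPhaseSpace N := fun n =>
    (P.rbScaled k₂ (Es n)).rbDriftGen Λ N (Es n ^ (2 / k₂ - 1)) (Es n ^ (1 / k₂ - 1 / 2)) with hY
  have hYc : ∀ n, Continuous (Y n) := fun n =>
    continuous_rbDriftGen_rbScaled₂ hU hV k₂ (hE0 n) Λ N _ _
  have hYxc : ∀ n, Continuous fun s => Y n (x n s) := fun n => (hYc n).comp (hxc n)
  have hYb : ∀ n, ∀ s ∈ Icc 0 Λ₀, ‖Y n (x n s)‖ ≤ M₁ := fun n s hs =>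
    (hbd (Es n) (hE1 n) (x n s) (hGM n s hs)).2.2.2.2.2
  have hxb : ∀ n, ∀ s ∈ Icc 0 Λ₀,
      (∀ i j : Fin N, j.val = i.val + 1 → |(x n s).1.1 j - (x n s).1.1 i| ≤ BΔ) ∧
      (∀ i, |(x n s).1.1 i| ≤ Bq * Es n ^ (1 / k₁ - 1 / k₂)) ∧ (∀ i, |(x n s).1.2 i| ≤ Cp) :=
    fun n s hs => ⟨(hbd (Es n) (hE1 n) (x n s) (hGM n s hs)).1,
      (hbd (Es n) (hE1 n) (x n s) (hGM n s hs)).2.1, (hbd (Es n) (hE1 n) (x n s) (hGM n s hs)).2.2.1⟩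
  have h0m : (0 : ℝ) ∈ Icc 0 Λ₀ := ⟨le_rfl, hΛ₀.le⟩
  have hη1 : ∀ n, ∀ s ∈ Icc 0 Λ₀, |(η n s).1| ≤ δ n ∧ |(η n s).2| ≤ δ n := fun n s hs =>
    ⟨((Real.norm_eq_abs _).symm.le.trans (norm_fst_le (η n s))).trans (hηb n s hs),
      ((Real.norm_eq_abs _).symm.le.trans (norm_snd_le (η n s))).trans (hηb n s hs)⟩
  -- the drift-driven part `y_n = x_n - (0, η_n)` and its integral equation
  set y : ℕ → ℝ → RBPhaseSpace N := fun n s => x n s - ((0 : PhaseSpace N), η n s) with hy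
  have hyIE : ∀ n, ∀ s ∈ Icc 0 Λ₀, y n s = x n 0 + ∫ u in (0 : ℝ)..s, Y n (x n u) := by
    intro n s hs
    have h' : x n s = x n 0 + ((0 : PhaseSpace N), η n s) + ∫ u in (0:ℝ)..s, Y n (x n u) :=
      hsol n s hs
    simp only [hy]
    rw [h']; abel
  have hxy : ∀ n s, x n s = y n s + ((0 : PhaseSpace N), η n s) := fun n s => by
    simp only [hy]; abel
  -- integral bound
  have hint : ∀ n, ∀ s ∈ Icc 0 Λ₀, ∀ t ∈ Icc 0 Λ₀,
      ‖(∫ u in (0:ℝ)..t, Y n (x n u)) - ∫ u in (0:ℝ)..s, Y n (x n u)‖ ≤ M₁ * |t - s| := by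
    intro n s hs t ht
    rw [intervalIntegral.integral_interval_sub_left ((hYxc n).intervalIntegrable _ _)
      ((hYxc n).intervalIntegrable _ _)]
    refine intervalIntegral.norm_integral_le_of_norm_le_const fun u hu => hYb n u ?_
    rcases le_total s t with hst | hst
    · rw [Set.uIoc_of_le hst] at hu; exact ⟨hs.1.trans hu.1.le, hu.2.trans ht.2⟩
    · rw [Set.uIoc_of_ge hst] at hu; exact ⟨ht.1.trans hu.1.le, hu.2.trans hs.2⟩
  have hint0 : ∀ n, ∀ s ∈ Icc 0 Λ₀, ‖∫ u in (0:ℝ)..s, Y n (x n u)‖ ≤ M₁ * Λ₀ := by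
    intro n s hs
    have hI := hint n 0 h0m s hs
    rw [intervalIntegral.integral_same, sub_zero, sub_zero, abs_of_nonneg hs.1] at hI
    exact hI.trans (mul_le_mul_of_nonneg_left hs.2 hM₁)
  -- uniform bound of the reservoir variables
  set R₁ : ℝ := R₀ + 1 + M₁ * Λ₀ with hR₁
  have hR₁0 : 0 ≤ R₁ := by rw [hR₁]; positivity
  have hrb : ∀ n, ∀ s ∈ Icc 0 Λ₀, |(x n s).2.1| ≤ R₁ ∧ |(x n s).2.2| ≤ R₁ := by
    intro n s hs
    have h1 := hyIE n s hs
    have hIΛ := hint0 n s hs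
    obtain ⟨-, -, e1, e2⟩ := abs_le_norm_rbPhaseSpace (∫ u in (0:ℝ)..s, Y n (x n u))
    obtain ⟨hη1s, hη2s⟩ := hη1 n s hs
    have c1 : (x n s).2.1 = (x n 0).2.1 + (η n s).1 + (∫ u in (0:ℝ)..s, Y n (x n u)).2.1 := by
      have := congrArg (fun v : RBPhaseSpace N => v.2.1) h1
      simp only [hy, Prod.snd_sub, Prod.fst_sub, Prod.snd_add, Prod.fst_add] at this
      linarith
    have c2 : (x n s).2.2 = (x n 0).2.2 + (η n s).2 + (∫ u in (0:ℝ)..s, Y n (x n u)).2.2 := by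
      have := congrArg (fun v : RBPhaseSpace N => v.2.2) h1
      simp only [hy, Prod.snd_sub, Prod.snd_add] at this
      linarith
    constructor
    · rw [c1]
      refine (abs_add_le _ _).trans ((add_le_add (abs_add_le _ _) le_rfl).trans ?_)
      rw [hR₁]; linarith [(hr0 n).1, hδ1 n]
    · rw [c2]
      refine (abs_add_le _ _).trans ((add_le_add (abs_add_le _ _) le_rfl).trans ?_)
      rw [hR₁]; linarith [(hr0 n).2, hδ1 n]
  -- positions drift little: `|q̃_i(s) - q̃_i(0)| ≤ M₁ Λ₀`
  have hqdrift : ∀ n, ∀ s ∈ Icc 0 Λ₀, ∀ i, |(x n s).1.1 i - (x n 0).1.1 i| ≤ M₁ * Λ₀ := by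
    intro n s hs i
    have h1 := hyIE n s hs
    obtain ⟨e1, -, -, -⟩ := abs_le_norm_rbPhaseSpace (∫ u in (0:ℝ)..s, Y n (x n u))
    have c1 : (x n s).1.1 i - (x n 0).1.1 i = (∫ u in (0:ℝ)..s, Y n (x n u)).1.1 i := by
      have := congrArg (fun v : RBPhaseSpace N => v.1.1 i) h1
      simp only [hy, Prod.fst_sub, Prod.fst_add, Pi.add_apply, sub_zero] at this
      linarith
    rw [c1]
    exact (e1 i).trans (hint0 n s hs)
  -- RECENTRING at `q̃_0(0)`
  set c : ℕ → ℝ := fun n => (x n 0).1.1 ⟨0, hN⟩ with hc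
  set T : ℕ → RBPhaseSpace N := fun n => (((fun _ => c n), (0 : Fin N → ℝ)), (0 : ℝ × ℝ)) with hT
  set x' : ℕ → ℝ → RBPhaseSpace N := fun n s => x n s - T n with hx'
  have hx'11 : ∀ n s i, (x' n s).1.1 i = (x n s).1.1 i - c n := fun n s i => by
    simp [hx', hT]
  have hx'12 : ∀ n s, (x' n s).1.2 = (x n s).1.2 := fun n s => by simp [hx', hT]
  have hx'2 : ∀ n s, (x' n s).2 = (x n s).2 := fun n s => by simp [hx', hT]
  have hx'c : ∀ n, Continuous (x' n) := fun n => (hxc n).sub continuous_const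
  -- the recentred positions are bounded
  set B' : ℝ := M₁ * Λ₀ + 2 * N * BΔ with hB'
  have hB'0 : 0 ≤ B' := by positivity
  have hq' : ∀ n, ∀ s ∈ Icc 0 Λ₀, ∀ i, |(x' n s).1.1 i| ≤ B' := by
    intro n s hs i
    rw [hx'11]
    have h1 := hqdrift n s hs i
    have h2 := abs_sub_le_of_bonds hBΔ (hxb n 0 h0m).1 i ⟨0, hN⟩
    have e : (x n s).1.1 i - c n = ((x n s).1.1 i - (x n 0).1.1 i) + ((x n 0).1.1 i - (x n 0).1.1 ⟨0, hN⟩) := by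
      simp only [hc]; ring
    rw [e]
    exact (abs_add_le _ _).trans (by rw [hB']; exact add_le_add h1 h2)
  -- the recentred drift-driven part `y'_n = y_n - T_n`
  set y' : ℕ → ℝ → RBPhaseSpace N := fun n s => y n s - T n with hy'
  have hy'IE : ∀ n, ∀ s ∈ Icc 0 Λ₀, y' n s = x' n 0 + ∫ u in (0 : ℝ)..s, Y n (x n u) := by
    intro n s hs
    simp only [hy', hx']
    rw [hyIE n s hs]; abel
  have hx'y' : ∀ n s, x' n s = y' n s + ((0 : PhaseSpace N), η n s) := fun n s => by
    simp only [hy', hx', hy]; abel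
  -- uniform bound of `y'_n` on `[0, Λ₀]`
  set Rb : ℝ := B' + Cp + R₁ + 1 with hRb
  have hRb0 : 0 ≤ Rb := by rw [hRb]; positivity
  have hy'bd : ∀ n, ∀ s ∈ Icc 0 Λ₀, ‖y' n s‖ ≤ Rb := by
    intro n s hs
    obtain ⟨-, -, hp⟩ := hxb n s hs
    obtain ⟨h1, h2⟩ := hrb n s hs
    obtain ⟨hη1s, hη2s⟩ := hη1 n s hs
    have hq := hq' n s hs
    refine norm_rbPhaseSpace_le hRb0 (fun i => ?_) (fun i => ?_) ?_ ?_
    · have e : (y' n s).1.1 i = (x' n s).1.1 i := by simp [hy', hx', hy, hT]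
      rw [e]; exact (hq i).trans (by rw [hRb]; linarith)
    · have e : (y' n s).1.2 i = (x n s).1.2 i := by simp [hy', hy, hT]
      rw [e]; exact (hp i).trans (by rw [hRb]; linarith)
    · have e : (y' n s).2.1 = (x n s).2.1 - (η n s).1 := by simp [hy', hy, hT]
      rw [e]; refine (abs_sub _ _).trans ?_; rw [hRb]; linarith [hδ1 n]
    · have e : (y' n s).2.2 = (x n s).2.2 - (η n s).2 := by simp [hy', hy, hT]
      rw [e]; refine (abs_sub _ _).trans ?_; rw [hRb]; linarith [hδ1 n]
  have hx'bd : ∀ n, ∀ s ∈ Icc 0 Λ₀, ‖x' n s‖ ≤ Rb + 1 := by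
    intro n s hs
    rw [hx'y' n s]
    refine (norm_add_le _ _).trans ?_
    rw [norm_zero_prod_rb]
    linarith [hy'bd n s hs, hηb n s hs, hδ1 n]
  -- equi-Lipschitz
  have hy'lip : ∀ n, LipschitzOnWith ⟨M₁, hM₁⟩ (y' n) (Icc 0 Λ₀) := by
    intro n
    refine LipschitzOnWith.of_dist_le_mul fun s hs t ht => ?_
    rw [dist_eq_norm, Real.dist_eq, hy'IE n s hs, hy'IE n t ht, add_sub_add_left_eq_sub]
    exact hint n t ht s hs
  -- Arzelà–Ascoli extraction
  obtain ⟨g, φ, hφ, hgc, -, hconv⟩ := exists_subseq_tendsto_of_lipschitz hΛ₀.le hy'bd hy'lip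
  have hφt : Tendsto φ atTop atTop := hφ.tendsto_atTop
  have hEφ : Tendsto (fun n => Es (φ n)) atTop atTop := hE.comp hφt
  -- uniform convergence `x'_{φ n} → g` on `[0, Λ₀]`
  have HX : ∀ ε > 0, ∀ᶠ n in atTop, ∀ u ∈ Icc 0 Λ₀, ‖x' (φ n) u - g u‖ ≤ ε := by
    intro ε hε
    have h2 : ∀ᶠ n in atTop, δ (φ n) < ε / 2 :=
      (hδ.comp hφt).eventually_lt_const (by positivity)
    filter_upwards [hconv (ε / 2) (by positivity), h2] with n h1n h2n u hu
    have e : x' (φ n) u - g u = (y' (φ n) u - g u) + ((0 : PhaseSpace N), η (φ n) u) := by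
      rw [hx'y' (φ n) u]; abel
    rw [e]
    refine (norm_add_le _ _).trans ?_
    rw [norm_zero_prod_rb]
    linarith [h1n u hu, hηb (φ n) u hu]
  have HXpt : ∀ u ∈ Icc 0 Λ₀, Tendsto (fun n => x' (φ n) u) atTop (𝓝 (g u)) := fun u hu =>
    tendsto_of_forall_eventually_norm_sub_le fun ε hε => (HX ε hε).mono fun n hn => hn u hu
  -- everything lives in a compact box
  set K : Set (RBPhaseSpace N) := closedBall 0 (Rb + 1) with hK
  have hKc : IsCompact K := isCompact_closedBall _ _
  have hx'K : ∀ n, ∀ u ∈ Icc 0 Λ₀, x' n u ∈ K := fun n u hu => by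
    rw [hK, mem_closedBall, dist_zero_right]; exact hx'bd n u hu
  have hgK : ∀ u ∈ Icc 0 Λ₀, g u ∈ K := fun u hu => by
    obtain ⟨n, hn⟩ := (hconv 1 one_pos).exists
    rw [hK, mem_closedBall, dist_zero_right]
    have := norm_sub_le_norm_sub_add_norm_sub (g u) (y' (φ n) u) 0
    simp only [sub_zero] at this
    rw [norm_sub_rev] at this
    linarith [hn u hu, hy'bd (φ n) u hu]
  -- the reservoir coefficients vanish in the limit (`k₂ > 2`)
  have hcp : Tendsto (fun n => Es (φ n) ^ (2 / k₂ - 1)) atTop (𝓝 0) := by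
    have hpos : 0 < 1 - 2 / k₂ := by
      rw [sub_pos, div_lt_one (by linarith)]; exact hk₂
    have h := (tendsto_rpow_neg_atTop hpos).comp hEφ
    have : (fun n => Es (φ n) ^ (2 / k₂ - 1)) = (fun x : ℝ => x ^ (-(1 - 2 / k₂))) ∘ fun n => Es (φ n) := by
      funext n; simp only [Function.comp]; congr 1; ring
    rw [this]; exact h
  have hcr : Tendsto (fun n => Es (φ n) ^ (1 / k₂ - 1 / 2)) atTop (𝓝 0) := by
    have hpos : 0 < 1 / 2 - 1 / k₂ := by
      rw [sub_pos]; exact one_div_lt_one_div_of_lt (by norm_num) hk₂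
    have h := (tendsto_rpow_neg_atTop hpos).comp hEφ
    have : (fun n => Es (φ n) ^ (1 / k₂ - 1 / 2)) = (fun x : ℝ => x ^ (-(1 / 2 - 1 / k₂))) ∘ fun n => Es (φ n) := by
      funext n; simp only [Function.comp]; congr 1; ring
    rw [this]; exact h
  -- the limiting drift: the FREE chain (no pinning, no reservoir feedback)
  set fVlim := RBGrowth.limitForce hV.coeff k₂ with hfVlim
  set D : RBPhaseSpace N → RBPhaseSpace N := rbDriftOf (fun _ => (0 : ℝ)) fVlim P.γ Λ N 0 0 with hD
  have hDc : Continuous D := continuous_rbDriftOf continuous_const (RBGrowth.continuous_limitForce _ hk₂') _ _ _ _ _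
  -- the rescaled drift at `x` is a drift at the recentred point with the SHIFTED pinning force
  have hYeq : ∀ n u, Y n (x n u) = rbDriftOf (fun w => deriv (RBGrowth.scaledPot P.U k₂ (Es n)) (w + c n))
      (deriv (RBGrowth.scaledPot P.V k₂ (Es n))) P.γ Λ N (Es n ^ (2 / k₂ - 1)) (Es n ^ (1 / k₂ - 1 / 2)) (x' n u) := by
    intro n u
    have e : x n u = (((fun i => (x' n u).1.1 i + c n, (x' n u).1.2), (x' n u).2) : RBPhaseSpace N) := by
      refine Prod.ext (Prod.ext (funext fun i => ?_) ?_) ?_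
      · show (x n u).1.1 i = (x' n u).1.1 i + c n
        rw [hx'11]; ring
      · show (x n u).1.2 = (x' n u).1.2
        rw [hx'12]
      · show (x n u).2 = (x' n u).2
        rw [hx'2]
    rw [hY]
    simp only
    rw [OscillatorChain.rbDriftGen_eq_rbDriftOf, OscillatorChain.rbScaled_U, OscillatorChain.rbScaled_V,
      OscillatorChain.rbScaled_γ, e, rbDriftOf_translate]
  -- KEY: uniform convergence of the drifts along the subsequence
  have HY : ∀ ε > 0, ∀ᶠ n in atTop, ∀ u ∈ Icc 0 Λ₀, ‖Y (φ n) (x (φ n) u) - D (g u)‖ ≤ ε := by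
    intro ε hε
    obtain ⟨ρ, hρ, hUC⟩ := Metric.uniformContinuousOn_iff.1
      (hKc.uniformContinuousOn_of_continuous hDc.continuousOn) (ε / 2) (by positivity)
    have h1 := HX (ρ / 2) (by positivity)
    set εF : ℝ := ε / 12 with hεF
    have hεF0 : 0 < εF := by positivity
    set S : ℝ := 2 * |Λ| * R₁ + |P.γ| * R₁ with hS
    have hS0 : 0 ≤ S := by positivity
    set εc : ℝ := ε / (4 * (S + 1)) with hεc
    have hεc0 : 0 < εc := by positivity
    have hεcS : εc * S ≤ ε / 4 := by
      rw [hεc, div_mul_eq_mul_div, div_le_div_iff₀ (by positivity) (by norm_num)]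
      nlinarith
    -- the shifted pinning force is small on `|w| ≤ B'`: `|w + c_n| ≤ (B' + Bq) E^{1/k₁-1/k₂}`
    have h2 := hEφ.eventually (hU.eventually_abs_deriv_scaledPot_le_of_lt (by linarith) hk (B' + Bq) hεF0)
    have h3 := hEφ.eventually (hV.eventually_forall_abs_deriv_scaledPot_sub_limitForce_le hk₂' (2 * B') hεF0)
    have h4 := eventually_abs_sub_le_of_tendsto hcp hεc0
    have h5 := eventually_abs_sub_le_of_tendsto hcr hεc0
    filter_upwards [h1, h2, h3, h4, h5] with n h1 h2 h3 h4 h5 u hu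
    have hq := hq' (φ n) u hu
    obtain ⟨hr₁, hr₂⟩ := hrb (φ n) u hu
    rw [← hx'2] at hr₁ hr₂
    have hE1' : 1 ≤ Es (φ n) := hE1 _
    have hEα : 1 ≤ Es (φ n) ^ (1 / k₁ - 1 / k₂) :=
      Real.one_le_rpow hE1' (by rw [sub_nonneg]; exact one_div_le_one_div_of_le (by linarith) hk.le)
    -- term A: `Ỹ_E(x) - D(x')`
    have hA : ‖Y (φ n) (x (φ n) u) - D (x' (φ n) u)‖ ≤ ε / 2 := by
      rw [hYeq, hD]
      refine (norm_rbDriftOf_sub_rbDriftOf_le hεF0.le hεc0.le hR₁0 hq hr₁ hr₂ (fun w hw => ?_)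
        (fun w hw => h3 w (abs_le.1 hw)) h4 h5).trans ?_
      · rw [sub_zero]
        refine h2 (w + c (φ n)) ((abs_add_le _ _).trans ?_)
        have hcb : |c (φ n)| ≤ Bq * Es (φ n) ^ (1 / k₁ - 1 / k₂) := (hxb (φ n) 0 h0m).2.1 ⟨0, hN⟩
        have hwb : |w| ≤ B' * Es (φ n) ^ (1 / k₁ - 1 / k₂) := hw.trans (by nlinarith)
        linarith
      · rw [← hS]
        linarith
    -- term B: `D(x') - D(g)`
    have hB : ‖D (x' (φ n) u) - D (g u)‖ ≤ ε / 2 := by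
      have := hUC (x' (φ n) u) (hx'K (φ n) u hu) (g u) (hgK u hu)
        (by rw [dist_eq_norm]; linarith [h1 u hu])
      rw [dist_eq_norm] at this
      exact this.le
    calc ‖Y (φ n) (x (φ n) u) - D (g u)‖
        ≤ ‖Y (φ n) (x (φ n) u) - D (x' (φ n) u)‖ + ‖D (x' (φ n) u) - D (g u)‖ :=
          norm_sub_le_norm_sub_add_norm_sub _ _ _
      _ ≤ ε := by linarith
  -- the limit integral equation
  have hgIE : IsIntegralSolutionOn D (fun _ => g 0) g Λ₀ := by
    intro t ht
    have hA : Tendsto (fun n => y' (φ n) t) atTop (𝓝 (g t)) :=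
      tendsto_of_forall_eventually_norm_sub_le fun ε hε => (hconv ε hε).mono fun n hn => hn t ht
    have hx0 : Tendsto (fun n => x' (φ n) 0) atTop (𝓝 (g 0)) := HXpt 0 h0m
    have hI : Tendsto (fun n => ∫ u in (0:ℝ)..t, Y (φ n) (x (φ n) u)) atTop
        (𝓝 (∫ u in (0:ℝ)..t, D (g u))) := by
      refine intervalIntegral.tendsto_integral_filter_of_dominated_convergence (fun _ => M₁)
        (Eventually.of_forall fun n => ((hYxc (φ n)).aestronglyMeasurable).restrict)
        (Eventually.of_forall fun n => ae_of_all _ fun u hu => hYb (φ n) u ?_)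
        intervalIntegrable_const (ae_of_all _ fun u hu => ?_)
      · rw [Set.uIoc_of_le ht.1] at hu; exact ⟨hu.1.le, hu.2.trans ht.2⟩
      · rw [Set.uIoc_of_le ht.1] at hu
        exact tendsto_of_forall_eventually_norm_sub_le fun ε hε =>
          (HY ε hε).mono fun n hn => hn u ⟨hu.1.le, hu.2.trans ht.2⟩
    have hB : Tendsto (fun n => y' (φ n) t) atTop (𝓝 (g 0 + ∫ u in (0:ℝ)..t, D (g u))) := by
      have : (fun n => y' (φ n) t) = fun n => x' (φ n) 0 + ∫ u in (0:ℝ)..t, Y (φ n) (x (φ n) u) :=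
        funext fun n => hy'IE (φ n) t ht
      rw [this]
      exact hx0.add hI
    exact tendsto_nhds_unique hA hB
  -- the limit has vanishing dissipation
  have hgd : ∫ s in (0 : ℝ)..Λ₀, ((g s).2.1 ^ 2 + (g s).2.2 ^ 2) = 0 := by
    have hA : Tendsto (fun n => ∫ s in (0 : ℝ)..Λ₀, ((x' (φ n) s).2.1 ^ 2 + (x' (φ n) s).2.2 ^ 2))
        atTop (𝓝 0) := by
      have := hdiss.comp hφt
      refine this.congr fun n => ?_
      simp only [Function.comp, hx'2]
    have hB : Tendsto (fun n => ∫ s in (0 : ℝ)..Λ₀, ((x' (φ n) s).2.1 ^ 2 + (x' (φ n) s).2.2 ^ 2))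
        atTop (𝓝 (∫ s in (0 : ℝ)..Λ₀, ((g s).2.1 ^ 2 + (g s).2.2 ^ 2))) := by
      have hmeas : ∀ n, Continuous fun s => (x' (φ n) s).2.1 ^ 2 + (x' (φ n) s).2.2 ^ 2 := fun n =>
        ((continuous_fst.comp (continuous_snd.comp (hx'c (φ n)))).pow 2).add
          ((continuous_snd.comp (continuous_snd.comp (hx'c (φ n)))).pow 2)
      refine intervalIntegral.tendsto_integral_filter_of_dominated_convergence (fun _ => R₁ ^ 2 + R₁ ^ 2)
        (Eventually.of_forall fun n => ((hmeas n).aestronglyMeasurable).restrict)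
        (Eventually.of_forall fun n => ae_of_all _ fun u hu => ?_)
        intervalIntegrable_const (ae_of_all _ fun u hu => ?_)
      · rw [Set.uIoc_of_le hΛ₀.le] at hu
        obtain ⟨h1, h2⟩ := hrb (φ n) u ⟨hu.1.le, hu.2⟩
        rw [← hx'2] at h1 h2
        rw [Real.norm_eq_abs, abs_of_nonneg (by positivity)]
        have ha : (x' (φ n) u).2.1 ^ 2 ≤ R₁ ^ 2 := by
          rw [← sq_abs]; exact pow_le_pow_left₀ (abs_nonneg _) h1 2
        have hb : (x' (φ n) u).2.2 ^ 2 ≤ R₁ ^ 2 := by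
          rw [← sq_abs]; exact pow_le_pow_left₀ (abs_nonneg _) h2 2
        linarith
      · rw [Set.uIoc_of_le hΛ₀.le] at hu
        have h := HXpt u ⟨hu.1.le, hu.2⟩
        have hF : Continuous fun v : RBPhaseSpace N => v.2.1 ^ 2 + v.2.2 ^ 2 := by fun_prop
        exact (hF.tendsto (g u)).comp h
    exact tendsto_nhds_unique hB hA
  -- the cascade for the free chain: `p ≡ 0`, all forces vanish, `r ≡ 0`
  have hr := reservoir_eq_zero_of_integral_sq_eq_zero hgc hΛ₀ hgd
  obtain ⟨hp0, hF0⟩ := limit_cascade continuous_const (RBGrowth.continuous_limitForce _ hk₂')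
    (RBGrowth.limitForce_injective hV.coeff_pos hk₂') hΛ hN hgc hΛ₀ hgIE hr
  -- hence the limit starts at `0`: positions equal `q_0`, constant (`p ≡ 0`), and `q_0(0) = 0`
  have hg0 : g 0 = 0 := by
    have hq0 : ∀ i, (g 0).1.1 i = (g 0).1.1 ⟨0, hN⟩ :=
      eq_of_forall_rbForceOf_zero_eq_zero (RBGrowth.limitForce_injective hV.coeff_pos hk₂')
        (RBGrowth.limitForce_zero _ _) (fun i => hF0 i 0 h0m) hN
    have hc0 : (g 0).1.1 ⟨0, hN⟩ = 0 := by
      have h := HXpt 0 h0m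
      have hcomp : Tendsto (fun n => (x' (φ n) 0).1.1 ⟨0, hN⟩) atTop (𝓝 ((g 0).1.1 ⟨0, hN⟩)) :=
        ((continuous_apply _).tendsto _).comp ((continuous_fst.tendsto _).comp ((continuous_fst.tendsto _).comp h))
      have hzero : (fun n => (x' (φ n) 0).1.1 ⟨0, hN⟩) = fun _ => 0 := by
        funext n; rw [hx'11]; simp [hc]
      rw [hzero] at hcomp
      exact (tendsto_nhds_unique hcomp tendsto_const_nhds)
    refine Prod.ext (Prod.ext (funext fun i => ?_) (funext fun i => hp0 i 0 h0m)) (Prod.ext (hr 0 h0m).1 (hr 0 h0m).2)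
    rw [hq0 i, hc0]; rfl
  -- but the rescaled kinetic+interaction energies at time `0` are at least `3/16` eventually
  obtain ⟨CV, hCV, hKle⟩ := OscillatorChain.intEnergy_rbScaled_le_of_norm_le (P := P) (N := N) hV hk₂0
  set b : ℕ → ℝ := fun n => N * (‖x' (φ n) 0‖ ^ 2 / 2) +
      N * (N * (CV * (1 / Es (φ n) + (2 * ‖x' (φ n) 0‖) ^ k₂))) with hb
  have hρ : Tendsto (fun n => ‖x' (φ n) 0‖) atTop (𝓝 0) := by
    have := (HXpt 0 h0m).sub_const (g 0)
    rw [sub_self] at this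
    have := this.norm
    simpa [hg0] using this
  have hinv : Tendsto (fun n => 1 / Es (φ n)) atTop (𝓝 0) := by
    have := tendsto_inv_atTop_zero.comp hEφ
    simpa [Function.comp_def] using this
  have hbt : Tendsto b atTop (𝓝 0) := by
    have hρ2 : Tendsto (fun n => ‖x' (φ n) 0‖ ^ 2) atTop (𝓝 0) := by
      simpa using hρ.pow 2
    have hρk2 : Tendsto (fun n => (2 * ‖x' (φ n) 0‖) ^ k₂) atTop (𝓝 0) := by
      have h2ρ : Tendsto (fun n => 2 * ‖x' (φ n) 0‖) atTop (𝓝 0) := by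
        simpa using hρ.const_mul 2
      have := h2ρ.rpow_const (p := k₂) (Or.inr hk₂0.le)
      simpa [Real.zero_rpow hk₂0.ne'] using this
    have := (((hρ2.div_const 2).const_mul (N : ℝ))).add
      ((((hinv.add hρk2).const_mul CV).const_mul (N : ℝ)).const_mul (N : ℝ))
    rw [show (N : ℝ) * (0 / 2) + (N : ℝ) * ((N : ℝ) * (CV * (0 + 0))) = 0 by ring] at this
    exact this
  -- the reservoir term at time `0` is `≤ E^{2/k₂-1} R₀²`, eventually `≤ 1/8`
  have hcpR : Tendsto (fun n => Es (φ n) ^ (2 / k₂ - 1) * R₀ ^ 2) atTop (𝓝 0) := by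
    simpa using hcp.mul_const (R₀ ^ 2)
  obtain ⟨n, hn1, hn2⟩ := ((hbt.eventually_lt_const (by norm_num : (0 : ℝ) < 3 / 16)).and
    (hcpR.eventually_lt_const (by norm_num : (0 : ℝ) < 1 / 8))).exists
  have hE1n := hE1 (φ n)
  have hKn := hKle (Es (φ n)) hE1n (x' (φ n) 0).1 ‖x' (φ n) 0‖ (norm_fst_le _)
  -- translation invariance: `H̃_int(x'(0)) = H̃_int(x(0))`
  have htr : (P.rbScaled k₂ (Es (φ n))).intEnergy N (x' (φ n) 0).1 =
      (P.rbScaled k₂ (Es (φ n))).intEnergy N (x (φ n) 0).1 := by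
    have e : (x' (φ n) 0).1 = (fun i => (x (φ n) 0).1.1 i - c (φ n), (x (φ n) 0).1.2) :=
      Prod.ext (funext fun i => hx'11 _ _ i) (hx'12 _ _)
    rw [e, OscillatorChain.intEnergy_translate]
  have hsplit := P.rbScaledEnergy_eq_split k₂ (Es (φ n)) N (x (φ n) 0)
  have hG := hG0 (φ n)
  have hregn := hreg (φ n)
  have hrr : Es (φ n) ^ (2 / k₂ - 1) * (((x (φ n) 0).2.1 ^ 2 + (x (φ n) 0).2.2 ^ 2) / 2) ≤
      Es (φ n) ^ (2 / k₂ - 1) * R₀ ^ 2 := by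
    refine mul_le_mul_of_nonneg_left ?_ (Real.rpow_nonneg (by linarith) _)
    have ha : (x (φ n) 0).2.1 ^ 2 ≤ R₀ ^ 2 := by
      rw [← sq_abs]; exact pow_le_pow_left₀ (abs_nonneg _) (hr0 (φ n)).1 2
    have hb' : (x (φ n) 0).2.2 ^ 2 ≤ R₀ ^ 2 := by
      rw [← sq_abs]; exact pow_le_pow_left₀ (abs_nonneg _) (hr0 (φ n)).2 2
    linarith
  have : (P.rbScaled k₂ (Es (φ n))).intEnergy N (x' (φ n) 0).1 ≤ b n := by rw [hb]; exact hKn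
  linarith

end Core

/-! ### The quantitative rescaled form -/

section Main

variable {P : OscillatorChain} {k₁ k₂ : ℝ} (hU : RBGrowth P.U k₁) (hV : RBGrowth P.V k₂)
  (hk₁ : 2 ≤ k₁) (hk : k₁ < k₂) {Λ : ℝ} (hΛ : Λ ≠ 0) (hN : 0 < N) {Λ₀ : ℝ} (hΛ₀ : 0 < Λ₀)
include hU hV hk₁ hk hΛ hN hΛ₀

/-- **The dissipation bound in the interaction regime (CEHR Prop. 5.3, §5.1; RBT Cor. 3.6),
quantitative rescaled form, `2 ≤ k₁ < k₂`.** Fix `Λ₀ > 0` and an energy ceiling `M`. There are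
`E₀ ≥ 1`, `δ₀ ∈ (0, 1]` and `ε₁ > 0` such that for every `E ≥ E₀`, every continuous solution
`x̃ = x̃(0) + (0, η̃) + ∫ Ỹ_E(x̃)` of the equations rescaled with the interaction exponent `k₂` on
`[0, Λ₀]`, with `G̃_E(x̃(0)) ≥ 1/2`, pinning energy at most the kinetic+interaction energy at time
`0`, `G̃_E ≤ M` on `[0, Λ₀]` and control `sup ‖η̃‖ ≤ δ₀`, one has `∫₀^{Λ₀}(r̃_L² + r̃_R²) ≥ ε₁`
(a large initial reservoir variable is handled directly by `reservoir_deviation_le`).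
[cite: ReyBelletThomas2002, Thm 3.3, Cor 3.6 (proof)] -/
theorem interaction_dissipation_lower_bound (M : ℝ) :
    ∃ E₀ δ₀ ε₁ : ℝ, 1 ≤ E₀ ∧ 0 < δ₀ ∧ δ₀ ≤ 1 ∧ 0 < ε₁ ∧ ∀ E : ℝ, E₀ ≤ E →
      ∀ (x : ℝ → RBPhaseSpace N) (η : ℝ → ℝ × ℝ), Continuous x →
        IsIntegralSolutionOn ((P.rbScaled k₂ E).rbDriftGen Λ N (E ^ (2 / k₂ - 1)) (E ^ (1 / k₂ - 1 / 2)))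
          (fun s => x 0 + ((0 : PhaseSpace N), η s)) x Λ₀ →
        1 / 2 ≤ P.rbScaledEnergy k₂ E N (x 0) →
        (P.rbScaled k₂ E).pinEnergy N (x 0).1.1 ≤ (P.rbScaled k₂ E).intEnergy N (x 0).1 →
        (∀ s ∈ Icc 0 Λ₀, ‖η s‖ ≤ δ₀) → (∀ s ∈ Icc 0 Λ₀, P.rbScaledEnergy k₂ E N (x s) ≤ M) →
        ε₁ ≤ ∫ s in (0 : ℝ)..Λ₀, ((x s).2.1 ^ 2 + (x s).2.2 ^ 2) := by
  obtain ⟨BΔ, Bq, Cp, Cr, M₁, -, -, -, -, hM₁, hbd⟩ :=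
    interaction_scaled_drift_bound (N := N) hU hV hk₁ hk.le Λ M
  set R₀ : ℝ := 2 + M₁ * Λ₀ with hR₀
  -- Case A (bounded initial reservoir variables): the compactness argument
  have caseA : ∃ E₀ δ₀ ε₁ : ℝ, 1 ≤ E₀ ∧ 0 < δ₀ ∧ δ₀ ≤ 1 ∧ 0 < ε₁ ∧ ∀ E : ℝ, E₀ ≤ E →
      ∀ (x : ℝ → RBPhaseSpace N) (η : ℝ → ℝ × ℝ), Continuous x →
        IsIntegralSolutionOn ((P.rbScaled k₂ E).rbDriftGen Λ N (E ^ (2 / k₂ - 1)) (E ^ (1 / k₂ - 1 / 2)))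
          (fun s => x 0 + ((0 : PhaseSpace N), η s)) x Λ₀ →
        1 / 2 ≤ P.rbScaledEnergy k₂ E N (x 0) →
        (P.rbScaled k₂ E).pinEnergy N (x 0).1.1 ≤ (P.rbScaled k₂ E).intEnergy N (x 0).1 →
        |(x 0).2.1| ≤ R₀ → |(x 0).2.2| ≤ R₀ →
        (∀ s ∈ Icc 0 Λ₀, ‖η s‖ ≤ δ₀) → (∀ s ∈ Icc 0 Λ₀, P.rbScaledEnergy k₂ E N (x s) ≤ M) →
        ε₁ ≤ ∫ s in (0 : ℝ)..Λ₀, ((x s).2.1 ^ 2 + (x s).2.2 ^ 2) := by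
    by_contra H
    have H' : ∀ n : ℕ, ∃ (E : ℝ) (x : ℝ → RBPhaseSpace N) (η : ℝ → ℝ × ℝ), (n : ℝ) + 1 ≤ E ∧
        Continuous x ∧
        IsIntegralSolutionOn ((P.rbScaled k₂ E).rbDriftGen Λ N (E ^ (2 / k₂ - 1)) (E ^ (1 / k₂ - 1 / 2)))
          (fun s => x 0 + ((0 : PhaseSpace N), η s)) x Λ₀ ∧
        1 / 2 ≤ P.rbScaledEnergy k₂ E N (x 0) ∧
        (P.rbScaled k₂ E).pinEnergy N (x 0).1.1 ≤ (P.rbScaled k₂ E).intEnergy N (x 0).1 ∧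
        |(x 0).2.1| ≤ R₀ ∧ |(x 0).2.2| ≤ R₀ ∧
        (∀ s ∈ Icc 0 Λ₀, ‖η s‖ ≤ 1 / ((n : ℝ) + 1)) ∧
        (∀ s ∈ Icc 0 Λ₀, P.rbScaledEnergy k₂ E N (x s) ≤ M) ∧
        ∫ s in (0 : ℝ)..Λ₀, ((x s).2.1 ^ 2 + (x s).2.2 ^ 2) < 1 / ((n : ℝ) + 1) := by
      intro n
      by_contra h'
      apply H
      have hn1 : (1 : ℝ) ≤ (n : ℝ) + 1 := by
        have : (0 : ℝ) ≤ n := Nat.cast_nonneg n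
        linarith
      refine ⟨(n : ℝ) + 1, 1 / ((n : ℝ) + 1), 1 / ((n : ℝ) + 1), hn1, by positivity,
        (div_le_one (by positivity)).2 hn1, by positivity,
        fun E hE x η hxc hIE hG hrg hr1 hr2 hη hGM => ?_⟩
      by_contra hlt
      exact h' ⟨E, x, η, hE, hxc, hIE, hG, hrg, hr1, hr2, hη, hGM, not_le.1 hlt⟩
    choose Es xs ηs hEs hxsc hIE hG hrg hr1 hr2 hηs hGMs hlt using H'
    have hn1 : ∀ n : ℕ, (1 : ℝ) ≤ (n : ℝ) + 1 := fun n => by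
      have : (0 : ℝ) ≤ n := Nat.cast_nonneg n
      linarith
    have hEt : Tendsto Es atTop atTop :=
      tendsto_atTop_mono hEs (tendsto_natCast_atTop_atTop.atTop_add tendsto_const_nhds)
    refine interaction_core_seq hU hV hk₁ hk hΛ hN hΛ₀ (M := M) (R₀ := R₀) (Es := Es)
      (δ := fun n => 1 / ((n : ℝ) + 1)) (x := xs) (η := ηs) (fun n => (hn1 n).trans (hEs n)) hEt
      tendsto_one_div_add_atTop_nhds_zero_nat (fun n => (div_le_one (by positivity)).2 (hn1 n))
      hxsc hIE hG hrg (fun n => ⟨hr1 n, hr2 n⟩) hηs hGMs ?_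
    refine squeeze_zero (fun n => intervalIntegral.integral_nonneg hΛ₀.le fun s _ => by positivity)
      (fun n => (hlt n).le) tendsto_one_div_add_atTop_nhds_zero_nat
  obtain ⟨E₀, δ₀, ε₁, hE₀, hδ₀, hδ₁, hε₁, hA⟩ := caseA
  refine ⟨E₀, δ₀, min ε₁ Λ₀, hE₀, hδ₀, hδ₁, lt_min hε₁ hΛ₀, fun E hE x η hxc hIE hG hrg hη hGM => ?_⟩
  by_cases hr : |(x 0).2.1| ≤ R₀ ∧ |(x 0).2.2| ≤ R₀
  · exact (min_le_left _ _).trans (hA E hE x η hxc hIE hG hrg hr.1 hr.2 hη hGM)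
  · -- Case B (a large initial reservoir variable): it stays `≥ 1` on `[0, Λ₀]`
    have hE1 : 1 ≤ E := hE₀.trans hE
    have hdev := reservoir_deviation_le hM₁ hIE (fun s hs => (hbd E hE1 (x s) (hGM s hs)).2.2.2.2.2)
    have hηc : ∀ s ∈ Icc 0 Λ₀, |(η s).1| ≤ 1 ∧ |(η s).2| ≤ 1 := fun s hs =>
      ⟨((Real.norm_eq_abs _).symm.le.trans (norm_fst_le (η s))).trans ((hη s hs).trans hδ₁),
        ((Real.norm_eq_abs _).symm.le.trans (norm_snd_le (η s))).trans ((hη s hs).trans hδ₁)⟩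
    have hlow : ∀ s ∈ Icc 0 Λ₀, (1 : ℝ) ≤ (x s).2.1 ^ 2 + (x s).2.2 ^ 2 := by
      intro s hs
      obtain ⟨d1, d2⟩ := hdev s hs
      obtain ⟨n1, n2⟩ := hηc s hs
      rcases not_and_or.1 hr with h | h
      · have h' : R₀ < |(x 0).2.1| := not_le.1 h
        have : 1 ≤ |(x s).2.1| := by
          have := abs_sub_abs_le_abs_sub (x 0).2.1 (x s).2.1
          have e : (x 0).2.1 - (x s).2.1 = -((x s).2.1 - (x 0).2.1 - (η s).1) - (η s).1 := by ring
          rw [e] at this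
          have h3 : |-((x s).2.1 - (x 0).2.1 - (η s).1)| + |(η s).1| ≤ M₁ * Λ₀ + 1 := by
            rw [abs_neg]; exact add_le_add d1 n1
          have := (this.trans (abs_sub _ _)).trans h3
          rw [hR₀] at h'; linarith
        nlinarith [abs_nonneg (x s).2.1, sq_abs (x s).2.1, sq_nonneg (x s).2.2]
      · have h' : R₀ < |(x 0).2.2| := not_le.1 h
        have : 1 ≤ |(x s).2.2| := by
          have := abs_sub_abs_le_abs_sub (x 0).2.2 (x s).2.2
          have e : (x 0).2.2 - (x s).2.2 = -((x s).2.2 - (x 0).2.2 - (η s).2) - (η s).2 := by ring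
          rw [e] at this
          have h3 : |-((x s).2.2 - (x 0).2.2 - (η s).2)| + |(η s).2| ≤ M₁ * Λ₀ + 1 := by
            rw [abs_neg]; exact add_le_add d2 n2
          have := (this.trans (abs_sub _ _)).trans h3
          rw [hR₀] at h'; linarith
        nlinarith [abs_nonneg (x s).2.2, sq_abs (x s).2.2, sq_nonneg (x s).2.1]
    have hcont : Continuous fun s => (x s).2.1 ^ 2 + (x s).2.2 ^ 2 := by fun_prop
    have hmono := intervalIntegral.integral_mono_on (μ := volume) hΛ₀.le intervalIntegrable_const
      (hcont.intervalIntegrable _ _) hlow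
    rw [intervalIntegral.integral_const, smul_eq_mul, mul_one, sub_zero] at hmono
    exact (min_le_right _ _).trans hmono

end Main

end Literature.MathematicalPhysics.KineticTheory.HeatConduction

end
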